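import Mathlib.Probability.Moments.MGFAnalytic
import Mathlib.Probability.Moments.Tilted
import Mathlib.Probability.Moments.Covariance
import Literature.MathematicalPhysics.QuantumLattice.TorusWilsonGibbs
import HarnessLib

/-!
# Feynman–Hellmann / fluctuation–response for Gibbs reweightings

The first-order response of an exponentially tilted (Gibbs-reweighted) expectation to the
tilting parameter is a covariance.  For a measure `μ` on `Ω`, a real random variable `X` and a
bounded observable `F`, the tilted family `μ_s = μ.tilted (s X) = Z(s)⁻¹ e^{sX} μ`
(`Z = mgf X μ`) satisfies

  `d/ds ∫ F dμ_s = ∫ F X dμ_s − (∫ F dμ_s)(∫ X dμ_s) = Cov_{μ_s}(F, X)`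

at every `s = t` in the interior of the interval where `e^{sX}` is `μ`-integrable
(`hasDerivAt_integral_tilted`, `hasDerivAt_integral_tilted_eq_covariance`; the numerator
`d/ds ∫ F e^{sX} dμ = ∫ F X e^{sX} dμ` is `hasDerivAt_integral_mul_exp_mul`, differentiation
under the integral sign dominated by `|X| e^{tX + ε|X|}`; the denominator is Mathlib's
`hasDerivAt_mgf`).  In the Gibbs convention `μ_β = Z(β)⁻¹ e^{−βH} μ` this is the
**Feynman–Hellmann / fluctuation–response identity** `d/dβ ⟨F⟩_β = −Cov_β(F, H)`
(`hasDerivAt_integral_tilted_neg`), valid at every real `β` when `H` is bounded and `μ` is finite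
(`integrableExpSet_eq_univ_of_abs_le`), and differentiating once more,
`d/dβ Cov_β(F, G) = −κ₃^β(F, G, H)` with `κ₃` the joint third cumulant
(`hasDerivAt_covariance_tilted_neg`).

Specialised to Wilson's lattice gauge theory on the discrete torus, whose finite-volume state
is the Gibbs reweighting `(Haar^{⊗ links}).tilted (−β S_W)` of product Haar measure by the Wilson
action (`wilsonMeasure_eq_tilted_pi`): for every bounded observable `F`,
`d/dβ ∫ F dμ_β = −Cov_β(F, S_W)` (`hasDerivAt_integral_wilsonMeasure`,
`hasDerivAt_integral_wilsonMeasure_eq_neg_covariance`) — the action `S_W = ∑ₚ (N − Re tr ρ(U_p))`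
is the observable conjugate to the coupling `β`, so `β`-derivatives of Wilson expectations are
(minus) plaquette-sum covariances, and `β`-derivatives of covariances are (minus) summed third
cumulants (`hasDerivAt_covariance_wilsonMeasure`).

Theorems only.  Source: Feynman–Hellmann / fluctuation–response for Gibbs reweightings
(B. Simon, *The Statistical Mechanics of Lattice Gases* I, Princeton 1993, §II.1); for the
lattice gauge theory setting E. Seiler, LNP 159 (1982), Ch. 1–2, and S. Chatterjee,
arXiv:1803.01950, §2–3.
-/

noncomputable section

open MeasureTheory ProbabilityTheory Filter Topology Real
open Literature.MathematicalPhysics.QuantumFieldTheory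

namespace Literature.MathematicalPhysics.QuantumLattice

/-! ### Exponential tilting: the derivative in the tilting parameter is a covariance -/

section Tilted

variable {Ω : Type*} {mΩ : MeasurableSpace Ω} {μ : Measure Ω} {X F G : Ω → ℝ} {t C : ℝ}

/-- **Differentiation under the integral sign for `s ↦ ∫ F e^{sX} dμ`**: for `t` in the
interior of the integrability interval of `e^{sX}` and `F` essentially bounded,
`d/ds ∫ F e^{sX} dμ |_{s=t} = ∫ F X e^{tX} dμ` (dominated differentiation, majorant
`C |X| e^{tX + ε|X|}`; the case `F = Xⁿ` is Mathlib's `hasDerivAt_integral_pow_mul_exp_real`).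
Feynman–Hellmann / fluctuation–response for Gibbs reweightings (B. Simon, The Statistical
Mechanics of Lattice Gases I, Princeton 1993, §II.1). [folklore] -/
theorem hasDerivAt_integral_mul_exp_mul (ht : t ∈ interior (integrableExpSet X μ))
    (hF : AEStronglyMeasurable F μ) (hC : ∀ᵐ ω ∂μ, ‖F ω‖ ≤ C) :
    HasDerivAt (fun s => ∫ ω, F ω * exp (s * X ω) ∂μ)
      (∫ ω, F ω * (X ω * exp (t * X ω)) ∂μ) t := by
  have hX : AEMeasurable X μ := aemeasurable_of_mem_interior_integrableExpSet ht
  have ht' := ht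
  rw [mem_interior_iff_mem_nhds, mem_nhds_iff_exists_Ioo_subset] at ht'
  obtain ⟨l, u, hlu, h_subset⟩ := ht'
  set ε : ℝ := ((t - l) ⊓ (u - t)) / 2 with hε
  have h_pos : 0 < (t - l) ⊓ (u - t) := by simp [hlu.1, hlu.2]
  have hε0 : 0 < ε := half_pos h_pos
  have hexp_meas : ∀ s : ℝ, AEStronglyMeasurable (fun ω => exp (s * X ω)) μ := fun s =>
    (measurable_exp.comp_aemeasurable (hX.const_mul s)).aestronglyMeasurable
  refine (hasDerivAt_integral_of_dominated_loc_of_deriv_le (x₀ := t)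
    (bound := fun ω => C * (|X ω| ^ 1 * exp (t * X ω + ε / 2 * |X ω|)))
    (F := fun s ω => F ω * exp (s * X ω))
    (F' := fun s ω => F ω * (X ω * exp (s * X ω))) (Metric.ball_mem_nhds t (half_pos hε0))
    ?_ ?_ ?_ ?_ ?_ ?_).2
  · exact Eventually.of_forall fun s => hF.mul (hexp_meas s)
  · exact Integrable.bdd_mul (interior_subset (s := integrableExpSet X μ) ht) hF hC
  · exact hF.mul (hX.aestronglyMeasurable.mul (hexp_meas t))
  · filter_upwards [hC] with ω hω s hs
    have hC0 : 0 ≤ C := (norm_nonneg _).trans hω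
    rw [norm_mul]
    refine mul_le_mul hω ?_ (norm_nonneg _) hC0
    rw [norm_mul, Real.norm_eq_abs, Real.norm_eq_abs, abs_exp, pow_one]
    refine mul_le_mul_of_nonneg_left (exp_le_exp.2 ?_) (abs_nonneg _)
    have hs' : |s - t| < ε / 2 := by
      rwa [Metric.mem_ball, dist_eq_norm, Real.norm_eq_abs] at hs
    have h1 : (s - t) * X ω ≤ |s - t| * |X ω| := by rw [← abs_mul]; exact le_abs_self _
    have h2 : |s - t| * |X ω| ≤ ε / 2 * |X ω| := mul_le_mul_of_nonneg_right hs'.le (abs_nonneg _)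
    nlinarith [h1, h2]
  · refine Integrable.const_mul ?_ C
    refine integrable_pow_abs_mul_exp_add_of_integrable_exp_mul ?_ ?_ ?_ ?_ (t := ε) 1
    · exact h_subset (add_half_inf_sub_mem_Ioo hlu)
    · exact h_subset (sub_half_inf_sub_mem_Ioo hlu)
    · positivity
    · rw [abs_of_pos hε0]; exact half_lt_self hε0
  · refine ae_of_all _ fun ω s _ => ?_
    have h1 : HasDerivAt (fun s : ℝ => s * X ω) (X ω) s := hasDerivAt_mul_const (X ω)
    have h2 := (h1.exp).const_mul (F ω)
    simpa [mul_comm (exp (s * X ω)) (X ω)] using h2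

/-- Expectations under the tilted measure `μ.tilted (t X)` as quotients `∫ g e^{tX} dμ / Z(t)`
with `Z = mgf X μ`. Feynman–Hellmann / fluctuation–response for Gibbs reweightings (B. Simon,
The Statistical Mechanics of Lattice Gases I, Princeton 1993, §II.1). [folklore] -/
theorem integral_tilted_eq_integral_mul_exp_div_mgf (g : Ω → ℝ) (t : ℝ) :
    ∫ ω, g ω ∂(μ.tilted (t * X ·)) = (∫ ω, g ω * exp (t * X ω) ∂μ) / mgf X μ t := by
  rw [integral_tilted_mul_eq_mgf, ← integral_div]
  congr 1 with ω
  rw [smul_eq_mul]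
  ring

/-- **Fluctuation–response for exponential tilting** (moment form): for `t` in the interior of
the integrability interval of `e^{sX}` and `F` essentially bounded,
`d/ds ∫ F d(μ.tilted (sX)) |_{s=t} = ∫ F X dμ_t − (∫ F dμ_t)(∫ X dμ_t)`, `μ_t = μ.tilted (tX)`
(quotient rule on `∫ F e^{sX} dμ / mgf X μ s`). Feynman–Hellmann / fluctuation–response for Gibbs
reweightings (B. Simon, The Statistical Mechanics of Lattice Gases I, Princeton 1993, §II.1).
[folklore] -/
theorem hasDerivAt_integral_tilted (ht : t ∈ interior (integrableExpSet X μ))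
    (hF : AEStronglyMeasurable F μ) (hC : ∀ᵐ ω ∂μ, ‖F ω‖ ≤ C) :
    HasDerivAt (fun s => ∫ ω, F ω ∂(μ.tilted (s * X ·)))
      (∫ ω, F ω * X ω ∂(μ.tilted (t * X ·)) -
        (∫ ω, F ω ∂(μ.tilted (t * X ·))) * ∫ ω, X ω ∂(μ.tilted (t * X ·))) t := by
  rcases eq_zero_or_neZero μ with rfl | hμ
  · simp only [tilted_zero_measure, integral_zero_measure, mul_zero, sub_zero]
    exact hasDerivAt_const t 0
  have hZ : HasDerivAt (mgf X μ) (∫ ω, X ω * exp (t * X ω) ∂μ) t := hasDerivAt_mgf ht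
  have hN := hasDerivAt_integral_mul_exp_mul ht hF hC
  have hZpos : 0 < mgf X μ t := mgf_pos' hμ.out (interior_subset (s := integrableExpSet X μ) ht)
  have key : HasDerivAt (fun s => (∫ ω, F ω * exp (s * X ω) ∂μ) / mgf X μ s)
      (((∫ ω, F ω * (X ω * exp (t * X ω)) ∂μ) * mgf X μ t -
        (∫ ω, F ω * exp (t * X ω) ∂μ) * ∫ ω, X ω * exp (t * X ω) ∂μ) / mgf X μ t ^ 2) t :=
    hN.div hZ hZpos.ne'
  have hfun : (fun s => ∫ ω, F ω ∂(μ.tilted (s * X ·))) =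
      fun s => (∫ ω, F ω * exp (s * X ω) ∂μ) / mgf X μ s :=
    funext fun s => integral_tilted_eq_integral_mul_exp_div_mgf F s
  rw [hfun]
  refine key.congr_deriv ?_
  rw [integral_tilted_eq_integral_mul_exp_div_mgf, integral_tilted_eq_integral_mul_exp_div_mgf,
    integral_tilted_eq_integral_mul_exp_div_mgf]
  have e1 : ∫ ω, F ω * X ω * exp (t * X ω) ∂μ = ∫ ω, F ω * (X ω * exp (t * X ω)) ∂μ :=
    integral_congr_ae (ae_of_all _ fun ω => by ring)
  rw [e1]
  set A := ∫ ω, F ω * (X ω * exp (t * X ω)) ∂μ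
  set B := ∫ ω, F ω * exp (t * X ω) ∂μ
  set D := ∫ ω, X ω * exp (t * X ω) ∂μ
  have hZne : mgf X μ t ≠ 0 := hZpos.ne'
  set Z := mgf X μ t
  field_simp

/-- **Fluctuation–response for exponential tilting** (covariance form): for `μ ≠ 0`, `t` in the
interior of the integrability interval of `e^{sX}` and `F` essentially bounded,
`d/ds ∫ F d(μ.tilted (sX)) |_{s=t} = Cov_{μ.tilted (tX)}(F, X)`. Feynman–Hellmann /
fluctuation–response for Gibbs reweightings (B. Simon, The Statistical Mechanics of Lattice
Gases I, Princeton 1993, §II.1). [folklore] -/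
theorem hasDerivAt_integral_tilted_eq_covariance [NeZero μ]
    (ht : t ∈ interior (integrableExpSet X μ))
    (hF : AEStronglyMeasurable F μ) (hC : ∀ᵐ ω ∂μ, ‖F ω‖ ≤ C) :
    HasDerivAt (fun s => ∫ ω, F ω ∂(μ.tilted (s * X ·))) (cov[F, X; μ.tilted (t * X ·)]) t := by
  haveI : IsProbabilityMeasure (μ.tilted (t * X ·)) :=
    isProbabilityMeasure_tilted (interior_subset (s := integrableExpSet X μ) ht)
  have hFt : MemLp F 2 (μ.tilted (t * X ·)) :=
    MemLp.of_bound (hF.mono_ac (tilted_absolutelyContinuous _ _)) C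
      ((tilted_absolutelyContinuous _ _).ae_le hC)
  have hXt : MemLp X 2 (μ.tilted (t * X ·)) := memLp_tilted_mul ht 2
  rw [covariance_eq_sub hFt hXt]
  exact hasDerivAt_integral_tilted ht hF hC

/-- For an essentially bounded `X` on a finite measure space, `e^{tX}` is integrable for every
real `t`: the integrability interval is all of `ℝ` (so the interior hypotheses above are void).
Feynman–Hellmann / fluctuation–response for Gibbs reweightings (B. Simon, The Statistical
Mechanics of Lattice Gases I, Princeton 1993, §II.1). [folklore] -/
theorem integrableExpSet_eq_univ_of_abs_le [IsFiniteMeasure μ] (hX : AEMeasurable X μ) {B : ℝ}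
    (hB : ∀ᵐ ω ∂μ, |X ω| ≤ B) : integrableExpSet X μ = Set.univ := by
  refine Set.eq_univ_of_forall fun t => ?_
  refine integrable_exp_mul_of_mem_Icc (a := -B) (b := B) hX ?_
  filter_upwards [hB] with ω hω using abs_le.1 hω

/-- **Feynman–Hellmann / fluctuation–response identity for Gibbs reweightings** (moment form):
for the Gibbs family `μ_β = Z(β)⁻¹ e^{−βH} μ = μ.tilted (−βH)` with `−β` in the interior of the
integrability interval of `e^{sH}` (every real `β` if `H` is bounded and `μ` finite, by
`integrableExpSet_eq_univ_of_abs_le`) and `F` essentially bounded,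
`d/dβ ∫ F dμ_β = −(∫ F H dμ_β − (∫ F dμ_β)(∫ H dμ_β))`. Feynman–Hellmann / fluctuation–response
for Gibbs reweightings (B. Simon, The Statistical Mechanics of Lattice Gases I, Princeton 1993,
§II.1). [folklore] -/
theorem hasDerivAt_integral_tilted_neg {H : Ω → ℝ} {β : ℝ}
    (hβ : -β ∈ interior (integrableExpSet H μ))
    (hF : AEStronglyMeasurable F μ) (hC : ∀ᵐ ω ∂μ, ‖F ω‖ ≤ C) :
    HasDerivAt (fun b : ℝ => ∫ ω, F ω ∂(μ.tilted (-b * H ·)))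
      (-(∫ ω, F ω * H ω ∂(μ.tilted (-β * H ·)) -
          (∫ ω, F ω ∂(μ.tilted (-β * H ·))) * ∫ ω, H ω ∂(μ.tilted (-β * H ·)))) β := by
  have h := (hasDerivAt_integral_tilted hβ hF hC).comp β (hasDerivAt_neg β)
  simpa [Function.comp_def] using h

/-- **Feynman–Hellmann / fluctuation–response identity for Gibbs reweightings** (covariance
form): for `μ ≠ 0`, `−β` in the interior of the integrability interval of `e^{sH}` and `F`
essentially bounded, `d/dβ ∫ F d(μ.tilted (−βH)) = −Cov_{μ.tilted (−βH)}(F, H)`.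
Feynman–Hellmann / fluctuation–response for Gibbs reweightings (B. Simon, The Statistical
Mechanics of Lattice Gases I, Princeton 1993, §II.1). [folklore] -/
theorem hasDerivAt_integral_tilted_neg_eq_neg_covariance [NeZero μ] {H : Ω → ℝ} {β : ℝ}
    (hβ : -β ∈ interior (integrableExpSet H μ))
    (hF : AEStronglyMeasurable F μ) (hC : ∀ᵐ ω ∂μ, ‖F ω‖ ≤ C) :
    HasDerivAt (fun b : ℝ => ∫ ω, F ω ∂(μ.tilted (-b * H ·)))
      (-cov[F, H; μ.tilted (-β * H ·)]) β := by
  have h := (hasDerivAt_integral_tilted_eq_covariance hβ hF hC).comp β (hasDerivAt_neg β)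
  simpa [Function.comp_def] using h

/-- **Second-order fluctuation–response**: the tilting derivative of a covariance of two
essentially bounded observables is the joint third cumulant with the tilting variable,
`d/ds Cov_{μ_s}(F, G) |_{s=t} = κ₃^{μ_t}(F, G, X)
 = E[FGX] − E[FG]E[X] − E[G]E[FX] − E[F]E[GX] + 2E[F]E[G]E[X]` (all moments under
`μ_t = μ.tilted (tX)`; product rule on `E[FG] − E[F]E[G]`). Feynman–Hellmann /
fluctuation–response for Gibbs reweightings (B. Simon, The Statistical Mechanics of Lattice
Gases I, Princeton 1993, §II.1). [folklore] -/
theorem hasDerivAt_covariance_tilted {D : ℝ} (ht : t ∈ interior (integrableExpSet X μ))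
    (hF : AEStronglyMeasurable F μ) (hC : ∀ᵐ ω ∂μ, ‖F ω‖ ≤ C)
    (hG : AEStronglyMeasurable G μ) (hD : ∀ᵐ ω ∂μ, ‖G ω‖ ≤ D) :
    HasDerivAt (fun s => ∫ ω, F ω * G ω ∂(μ.tilted (s * X ·)) -
        (∫ ω, F ω ∂(μ.tilted (s * X ·))) * ∫ ω, G ω ∂(μ.tilted (s * X ·)))
      (∫ ω, F ω * G ω * X ω ∂(μ.tilted (t * X ·)) -
        (∫ ω, F ω * G ω ∂(μ.tilted (t * X ·))) * (∫ ω, X ω ∂(μ.tilted (t * X ·))) -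
        (∫ ω, G ω ∂(μ.tilted (t * X ·))) * (∫ ω, F ω * X ω ∂(μ.tilted (t * X ·))) -
        (∫ ω, F ω ∂(μ.tilted (t * X ·))) * (∫ ω, G ω * X ω ∂(μ.tilted (t * X ·))) +
        2 * ((∫ ω, F ω ∂(μ.tilted (t * X ·))) * (∫ ω, G ω ∂(μ.tilted (t * X ·))) *
          ∫ ω, X ω ∂(μ.tilted (t * X ·)))) t := by
  have hFG : AEStronglyMeasurable (fun ω => F ω * G ω) μ := hF.mul hG
  have hCD : ∀ᵐ ω ∂μ, ‖F ω * G ω‖ ≤ C * D := by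
    filter_upwards [hC, hD] with ω hωC hωD
    rw [norm_mul]
    exact mul_le_mul hωC hωD (norm_nonneg _) ((norm_nonneg _).trans hωC)
  have h1 := hasDerivAt_integral_tilted ht hFG hCD
  have h2 := hasDerivAt_integral_tilted ht hF hC
  have h3 := hasDerivAt_integral_tilted ht hG hD
  have h : HasDerivAt (fun s => ∫ ω, F ω * G ω ∂(μ.tilted (s * X ·)) -
      (∫ ω, F ω ∂(μ.tilted (s * X ·))) * ∫ ω, G ω ∂(μ.tilted (s * X ·)))
      ((∫ ω, F ω * G ω * X ω ∂(μ.tilted (t * X ·)) -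
        (∫ ω, F ω * G ω ∂(μ.tilted (t * X ·))) * ∫ ω, X ω ∂(μ.tilted (t * X ·))) -
       ((∫ ω, F ω * X ω ∂(μ.tilted (t * X ·)) -
          (∫ ω, F ω ∂(μ.tilted (t * X ·))) * ∫ ω, X ω ∂(μ.tilted (t * X ·))) *
          (∫ ω, G ω ∂(μ.tilted (t * X ·))) +
        (∫ ω, F ω ∂(μ.tilted (t * X ·))) *
          (∫ ω, G ω * X ω ∂(μ.tilted (t * X ·)) -
            (∫ ω, G ω ∂(μ.tilted (t * X ·))) * ∫ ω, X ω ∂(μ.tilted (t * X ·))))) t :=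
    h1.sub (h2.mul h3)
  refine h.congr_deriv ?_
  ring

/-- **Second-order Feynman–Hellmann for Gibbs reweightings**: in the Gibbs convention
`μ_β = μ.tilted (−βH)`, `d/dβ Cov_β(F, G) = −κ₃^β(F, G, H)` for essentially bounded `F, G`
(`κ₃` the joint third cumulant, written out in moments). Feynman–Hellmann /
fluctuation–response for Gibbs reweightings (B. Simon, The Statistical Mechanics of Lattice
Gases I, Princeton 1993, §II.1). [folklore] -/
theorem hasDerivAt_covariance_tilted_neg {H : Ω → ℝ} {β D : ℝ}
    (hβ : -β ∈ interior (integrableExpSet H μ))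
    (hF : AEStronglyMeasurable F μ) (hC : ∀ᵐ ω ∂μ, ‖F ω‖ ≤ C)
    (hG : AEStronglyMeasurable G μ) (hD : ∀ᵐ ω ∂μ, ‖G ω‖ ≤ D) :
    HasDerivAt (fun b : ℝ => ∫ ω, F ω * G ω ∂(μ.tilted (-b * H ·)) -
        (∫ ω, F ω ∂(μ.tilted (-b * H ·))) * ∫ ω, G ω ∂(μ.tilted (-b * H ·)))
      (-(∫ ω, F ω * G ω * H ω ∂(μ.tilted (-β * H ·)) -
        (∫ ω, F ω * G ω ∂(μ.tilted (-β * H ·))) * (∫ ω, H ω ∂(μ.tilted (-β * H ·))) -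
        (∫ ω, G ω ∂(μ.tilted (-β * H ·))) * (∫ ω, F ω * H ω ∂(μ.tilted (-β * H ·))) -
        (∫ ω, F ω ∂(μ.tilted (-β * H ·))) * (∫ ω, G ω * H ω ∂(μ.tilted (-β * H ·))) +
        2 * ((∫ ω, F ω ∂(μ.tilted (-β * H ·))) * (∫ ω, G ω ∂(μ.tilted (-β * H ·))) *
          ∫ ω, H ω ∂(μ.tilted (-β * H ·))))) β := by
  have h := (hasDerivAt_covariance_tilted hβ hF hC hG hD).comp β (hasDerivAt_neg β)
  simpa [Function.comp_def] using h

end Tilted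

/-! ### Wilson's lattice gauge theory on the torus: `d/dβ ⟨F⟩_β = −Cov_β(F, S_W)` -/

section Wilson

variable {d L N : ℕ} {G : Type*} [Group G] [TopologicalSpace G] [IsTopologicalGroup G]
  [CompactSpace G] [MeasurableSpace G] [BorelSpace G] [SecondCountableTopology G] [NeZero L]
  {ρ : G →* Matrix (Fin N) (Fin N) ℂ} {C : ℝ}

/-- The Wilson action has all exponential moments under product Haar measure (it is bounded on
the compact configuration space): the integrability interval of `e^{s S_W}` is `ℝ`.
(E. Seiler, LNP 159, Ch. 1–2; S. Chatterjee, arXiv:1803.01950, §2–3.) [folklore] -/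
theorem integrableExpSet_wilsonAction_eq_univ (hρ : Continuous ρ) :
    integrableExpSet (fun U : GaugeConfig d L G => wilsonAction ρ U)
      (Measure.pi fun _ : Edge d L => haarProbability G) = Set.univ := by
  obtain ⟨B, hB⟩ := exists_abs_wilsonAction_le (d := d) (L := L) ρ hρ
  exact integrableExpSet_eq_univ_of_abs_le (measurable_wilsonAction ρ hρ).aemeasurable
    (ae_of_all _ hB)

/-- **Feynman–Hellmann for Wilson's lattice gauge theory** (moment form): on the discrete torus,
for every essentially bounded observable `F` (w.r.t. product Haar measure) and every real `β`,
`d/dβ ∫ F dμ_β = −(∫ F S_W dμ_β − (∫ F dμ_β)(∫ S_W dμ_β))`, `μ_β = wilsonMeasure ρ β`: the Wilson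
action is the observable conjugate to the coupling. Feynman–Hellmann / fluctuation–response for
Gibbs reweightings (B. Simon, The Statistical Mechanics of Lattice Gases I, Princeton 1993,
§II.1); lattice gauge setting E. Seiler, LNP 159 (1982), Ch. 1–2. [folklore] -/
theorem hasDerivAt_integral_wilsonMeasure (hρ : Continuous ρ) {F : GaugeConfig d L G → ℝ}
    (hF : AEStronglyMeasurable F (Measure.pi fun _ : Edge d L => haarProbability G))
    (hC : ∀ᵐ U ∂(Measure.pi fun _ : Edge d L => haarProbability G), ‖F U‖ ≤ C) (β : ℝ) :
    HasDerivAt (fun b : ℝ => ∫ U, F U ∂(wilsonMeasure (d := d) (L := L) ρ b))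
      (-(∫ U, F U * wilsonAction ρ U ∂(wilsonMeasure (d := d) (L := L) ρ β) -
          (∫ U, F U ∂(wilsonMeasure (d := d) (L := L) ρ β)) *
            ∫ U, wilsonAction ρ U ∂(wilsonMeasure (d := d) (L := L) ρ β))) β := by
  have hβ : -β ∈ interior (integrableExpSet (fun U : GaugeConfig d L G => wilsonAction ρ U)
      (Measure.pi fun _ : Edge d L => haarProbability G)) := by
    rw [integrableExpSet_wilsonAction_eq_univ hρ, interior_univ]; trivial
  have h := hasDerivAt_integral_tilted_neg hβ hF hC
  simp only [← wilsonMeasure_eq_tilted_pi ρ hρ] at h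
  exact h

/-- **Feynman–Hellmann for Wilson's lattice gauge theory** (covariance form):
`d/dβ ∫ F d(wilsonMeasure ρ β) = −Cov_{wilsonMeasure ρ β}(F, S_W)` for every essentially bounded
observable `F` and every real `β`. Feynman–Hellmann / fluctuation–response for Gibbs
reweightings (B. Simon, The Statistical Mechanics of Lattice Gases I, Princeton 1993, §II.1);
lattice gauge setting E. Seiler, LNP 159 (1982), Ch. 1–2. [folklore] -/
theorem hasDerivAt_integral_wilsonMeasure_eq_neg_covariance (hρ : Continuous ρ)
    {F : GaugeConfig d L G → ℝ}
    (hF : AEStronglyMeasurable F (Measure.pi fun _ : Edge d L => haarProbability G))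
    (hC : ∀ᵐ U ∂(Measure.pi fun _ : Edge d L => haarProbability G), ‖F U‖ ≤ C) (β : ℝ) :
    HasDerivAt (fun b : ℝ => ∫ U, F U ∂(wilsonMeasure (d := d) (L := L) ρ b))
      (-cov[F, fun U => wilsonAction ρ U; wilsonMeasure (d := d) (L := L) ρ β]) β := by
  haveI : IsProbabilityMeasure (Measure.pi fun _ : Edge d L => haarProbability G) := by
    infer_instance
  have hβ : -β ∈ interior (integrableExpSet (fun U : GaugeConfig d L G => wilsonAction ρ U)
      (Measure.pi fun _ : Edge d L => haarProbability G)) := by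
    rw [integrableExpSet_wilsonAction_eq_univ hρ, interior_univ]; trivial
  have h := hasDerivAt_integral_tilted_neg_eq_neg_covariance hβ hF hC
  simp only [← wilsonMeasure_eq_tilted_pi ρ hρ] at h
  exact h

/-- **Second-order Feynman–Hellmann for Wilson's lattice gauge theory**: for essentially
bounded observables `F, G` on the torus and every real `β`,
`d/dβ Cov_β(F, G) = −κ₃^β(F, G, S_W)` under `μ_β = wilsonMeasure ρ β` (the joint third cumulant
with the Wilson action, written out in moments) — `β`-derivatives of connected two-point
functions are minus plaquette-summed connected three-point functions. Feynman–Hellmann /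
fluctuation–response for Gibbs reweightings (B. Simon, The Statistical Mechanics of Lattice
Gases I, Princeton 1993, §II.1); lattice gauge setting E. Seiler, LNP 159 (1982), Ch. 1–2.
[folklore] -/
theorem hasDerivAt_covariance_wilsonMeasure (hρ : Continuous ρ) {F G' : GaugeConfig d L G → ℝ}
    {D : ℝ}
    (hF : AEStronglyMeasurable F (Measure.pi fun _ : Edge d L => haarProbability G))
    (hC : ∀ᵐ U ∂(Measure.pi fun _ : Edge d L => haarProbability G), ‖F U‖ ≤ C)
    (hG : AEStronglyMeasurable G' (Measure.pi fun _ : Edge d L => haarProbability G))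
    (hD : ∀ᵐ U ∂(Measure.pi fun _ : Edge d L => haarProbability G), ‖G' U‖ ≤ D) (β : ℝ) :
    HasDerivAt (fun b : ℝ => ∫ U, F U * G' U ∂(wilsonMeasure (d := d) (L := L) ρ b) -
        (∫ U, F U ∂(wilsonMeasure (d := d) (L := L) ρ b)) *
          ∫ U, G' U ∂(wilsonMeasure (d := d) (L := L) ρ b))
      (-(∫ U, F U * G' U * wilsonAction ρ U ∂(wilsonMeasure (d := d) (L := L) ρ β) -
        (∫ U, F U * G' U ∂(wilsonMeasure (d := d) (L := L) ρ β)) *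
          (∫ U, wilsonAction ρ U ∂(wilsonMeasure (d := d) (L := L) ρ β)) -
        (∫ U, G' U ∂(wilsonMeasure (d := d) (L := L) ρ β)) *
          (∫ U, F U * wilsonAction ρ U ∂(wilsonMeasure (d := d) (L := L) ρ β)) -
        (∫ U, F U ∂(wilsonMeasure (d := d) (L := L) ρ β)) *
          (∫ U, G' U * wilsonAction ρ U ∂(wilsonMeasure (d := d) (L := L) ρ β)) +
        2 * ((∫ U, F U ∂(wilsonMeasure (d := d) (L := L) ρ β)) *
          (∫ U, G' U ∂(wilsonMeasure (d := d) (L := L) ρ β)) *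
          ∫ U, wilsonAction ρ U ∂(wilsonMeasure (d := d) (L := L) ρ β)))) β := by
  have hβ : -β ∈ interior (integrableExpSet (fun U : GaugeConfig d L G => wilsonAction ρ U)
      (Measure.pi fun _ : Edge d L => haarProbability G)) := by
    rw [integrableExpSet_wilsonAction_eq_univ hρ, interior_univ]; trivial
  have h := hasDerivAt_covariance_tilted_neg hβ hF hC hG hD
  simp only [← wilsonMeasure_eq_tilted_pi ρ hρ] at h
  exact h

end Wilson

end Literature.MathematicalPhysics.QuantumLattice

end
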